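/-
Copyright (c) 2026 the pub-hodgecm-mathlib formalisation cell (harness21).  Prover seat hodgecm-mathlib-LH4-p09 (g3), req620 Track A «(D-RAM) FOUR-FRAME» squad
(unit U3_Laws, κ-STAGE B brick κB-G «GLUED-STRATA κ-SOCKETS», dealer LH4-plan (g11) WORD #32 (3); letter `F0/P3c/LH4/LH4-p09/g3/LETTER-kappaBG-RHS.v1.LH4p09g3.md` §0,
LH4-p05 (g3) «=» 2026-09-04T01:37:11Z).  FILE κG-C1.  2026-09-04.
-/
import Summits.HodgeConjecture.HodgeConjecture.Theorems.F0P3cDyRamDiagonalKappaGluedClassForm         -- ★ κG-A1 p856611 (this seat): `kappaCount_mapGL_diagGLUnits`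
import Summits.HodgeConjecture.HodgeConjecture.Theorems.F0P3cDyRamDiagonalGluedFootClasses            -- ★ F3a (LH4-p08 (g2)): `mapGL_latt_glued_eq_iff_kappa`
import Summits.HodgeConjecture.HodgeConjecture.Theorems.F0P3cDyRamDiagonalGluedTorusOrbits             -- ★ (iv-a) p855894 (LH4-p08 (g2)): orbit lemmas, dualisability criterion in `κ`
import Summits.HodgeConjecture.HodgeConjecture.Theorems.F0P3cDyRamDiagonalGluedStabiliserIndexFull    -- ★ (iv-b-idx) p856033: `ncard_unitTorus_orbit_latt_glued_eq`; brings ★ B5 (iii) FILE 2 (`stabiliserWeight_latt_glued_tube_eq`)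
import Summits.HodgeConjecture.HodgeConjecture.Theorems.F0P3cDyRamDiagonalGluedStability              -- ★ B5 (ii) p855795 (LH4-p10 (g2)): `mapGL_latt_hnf_glued_eq_of_depths`
import Summits.HodgeConjecture.HodgeConjecture.Theorems.F0P3cDyRamDiagonalPairReindex                 -- ★ (O2a) p855745 (LH4-p04 (g2)): `mapGL_mapGL_diagGLUnits_eq_iff` (T-stability is constant along torus orbits)
import Summits.HodgeConjecture.HodgeConjecture.Theorems.F0P3cDyRamDiagonalStratumTools                 -- ★ (LH4-p13 (g2)): `finsum_mem_eq_ncard_mul`, `stabiliserWeight_mapGL_diagGLUnits`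
import Mathlib.Data.Set.Card.Arithmetic
import HarnessLib

/-!
# Crux `H413`, line LH4 «(D-RAM) FOUR-FRAME» road — unit U3_Laws (iii), κ-STAGE B brick κB-G, FILE κG-C1 «THE κ-CENSUS OF THE GLUED FAMILY, DECOMPOSED BY CLASSES»:
# `Σᶠ_{M glued, T-stable, dualisable} κ_i(M)·w(M) = q^{2ρ+t−⌈ρ∕2⌉} · Σ_{g ∈ R, latt V(1,1,g) T-stable} κ_i(latt V(1,1,g))`

Cell `hodgecm-mathlib` (D-0151), FLOOR 0, crux item H413 = `stmt-HodgeConjecture-24833`, route of record `HCCMUnconditional`; squad F0∕P3c∕LH4 (req618∕req620).  THEOREMS ONLY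
(no `def`, no instance, no notation, no `sorry`); lane `--supports stmt-HodgeConjecture-24833 --as helper` (count-neutral).  LAW-FREE.

THE MATHEMATICS (★ F3b `finsum_stabiliserWeight_glued_foot_eq_ncard_mul`'s orbit–stabiliser route with the κ-weight inserted).  `T = diag(s)` a unit diagonal; the glued family of
`G₁(2ρ, 2t)` is `{latt V(x,ζ,y″)}`; by ★ (iv-a)∕(iv-c) its dualisable members are the unit-torus orbits of the representatives `latt V(1,1,g)`, `g ∈ R` (a complete irredundant system of
the fixed elements of valuation `|ϖ|^{2t}` modulo `𝔭^{ρ+2t}`); T-STABILITY is constant along every orbit (★ `mapGL_mapGL_diagGLUnits_eq_iff`), so the stable dualisable family is the disjoint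
union of the orbits of the STABLE representatives; on each orbit the κ-count is constant (★ κG-A1 `kappaCount_mapGL_diagGLUnits`) and so is the weight (★ B5 (iii)), and
`|orbit| · w = q^{2ρ + 2t − ⌈(ρ+2t)∕2⌉} = q^{2ρ+t−⌈ρ∕2⌉}` (★ (iv-b-idx)).
* §1 `orbit_mass_eq_pow` — `((q−1)q^{ρ+2t−1})((q−1)q^{2ρ−1}) ∕ (((q−1)q^{⌈(ρ+2t)∕2⌉−1})((q−1)q^{ρ−1})) = q^{2ρ + 2t − ⌈(ρ+2t)∕2⌉}` in `ℚ`.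
* §2 **`finsum_kappaCount_mul_stabiliserWeight_glued_eq`** — the decomposition (any slot `i`, any regime, any system `R`, reference frames `V₀ g` passed by the caller).
* §3 the stable representatives by regime: `forall_mapGL_latt_glued_rep_of_depths` (TUBE: all), `mapGL_latt_glued_rep_iff` (FOOT: `|g + (β−1)∕(α−1)| ≤ |ϖ|^{2ρ+2t−m}`, ★ F3a at `x = ζ = 1`).
HONEST LABEL.  Count-neutral (`--supports`); nothing printed is asserted; (KMS)∕(KSS) stay PROVER TARGETS; `HC_CM` is proved only modulo the 7 printed citations (2 remaining named inputs:
hLiu418 = `stmt-HodgeConjecture-24832`, h413 = `stmt-HodgeConjecture-24833`) until rung 0 closes.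

## References
* [Kottwitz1986BaseChangeUnits] R. E. Kottwitz, *Base change for unit elements of Hecke algebras*, Compositio Math. 60 (1986), §1 pp. 240–241 (κ-weighted fixed-lattice counts via
  torus orbits and stabilisers).
* [Rogawski1990] J. D. Rogawski, *Automorphic Representations of Unitary Groups in Three Variables*, Ann. of Math. Stud. 123 (1990), §4.9 Prop. 4.9.1 (a) p. 55.
* [LanglandsShelstad1987] R. P. Langlands, D. Shelstad, *On the definition of transfer factors*, Math. Ann. 278 (1987), §3.
-/

set_option autoImplicit false

noncomputable section

namespace Summit.HodgeConjecture.HodgeConjecture.Cruxes.H413.F0P3cDyRamDiagonalKappaGluedDecomposition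

open Matrix WithZero
open Literature.NumberTheory.Automorphic Literature.NumberTheory.Automorphic.HermitianLattice
open Literature.NumberTheory.Automorphic.UnitaryLatticeTree
open Summit.HodgeConjecture.HodgeConjecture.Cruxes.H413.F0P3cDyRamDiagonalTorusDefs
open Summit.HodgeConjecture.HodgeConjecture.Cruxes.H413.F0P3cDyRamDiagonalKappaCountDefs
open Summit.HodgeConjecture.HodgeConjecture.Cruxes.H413.F0P3cDyRamDiagonalKappaGluedClassForm (kappaCount_mapGL_diagGLUnits)
open Summit.HodgeConjecture.HodgeConjecture.Cruxes.H413.F0P3cDyRamDiagonalGluedTorusOrbits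
open Summit.HodgeConjecture.HodgeConjecture.Cruxes.H413.F0P3cDyRamDiagonalGluedStabiliserIndex (stabiliserWeight_latt_glued_tube_eq ne_zero_and_v_lt_one_of_v_eq_exp)
open Summit.HodgeConjecture.HodgeConjecture.Cruxes.H413.F0P3cDyRamDiagonalGluedStabiliserIndexFull (ncard_unitTorus_orbit_latt_glued_eq)
open Summit.HodgeConjecture.HodgeConjecture.Cruxes.H413.F0P3cDyRamDiagonalGluedFootClasses (mapGL_latt_glued_eq_iff_kappa)
open Summit.HodgeConjecture.HodgeConjecture.Cruxes.H413.F0P3cDyRamDiagonalGluedStability (mapGL_latt_hnf_glued_eq_of_depths)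
open Summit.HodgeConjecture.HodgeConjecture.Cruxes.H413.F0P3cDyRamDiagonalPairReindex (mapGL_mapGL_diagGLUnits_eq_iff)
open Summit.HodgeConjecture.HodgeConjecture.Cruxes.H413.F0P3cDyRamDiagonalStratumTools (finsum_mem_eq_ncard_mul stabiliserWeight_mapGL_diagGLUnits)
open scoped Valued WithZero Matrix MatrixGroups

variable {K : Type} [Field K] [Valued K ℤᵐ⁰]

/-! ## §1  The mass of one orbit -/

/-- **`|𝒯-orbit| · weight = q^{2ρ + 2t − ⌈(ρ+2t)∕2⌉}`** on the glued stratum `G₁(2ρ, 2t)` (`ρ ≥ 1`, `q ≥ 2`): `((q−1)q^{ρ+2t−1})((q−1)q^{2ρ−1})` members (★ (iv-b-idx)) of weight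
`(((q−1)q^{⌈(ρ+2t)∕2⌉−1})((q−1)q^{ρ−1}))⁻¹` (★ B5 (iii)). [cite: Kottwitz1986BaseChangeUnits, §1 pp. 240–241] -/
theorem orbit_mass_eq_pow {q ρ : ℕ} (hq : 1 < q) (hρ : 1 ≤ ρ) (t : ℕ) :
    ((((q - 1) * q ^ (ρ + 2 * t - 1)) * ((q - 1) * q ^ (2 * ρ - 1)) : ℕ) : ℚ) *
        ((((q - 1) * q ^ ((ρ + 2 * t + 1) / 2 - 1)) * ((q - 1) * q ^ (ρ - 1)) : ℕ) : ℚ)⁻¹ =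
      (q : ℚ) ^ (2 * ρ + 2 * t - (ρ + 2 * t + 1) / 2) := by
  have hq1 : ((q : ℚ) - 1) ≠ 0 := sub_ne_zero.2 (by exact_mod_cast hq.ne')
  have hq0 : (q : ℚ) ≠ 0 := by exact_mod_cast (by omega : q ≠ 0)
  have hden : ((((q - 1) * q ^ ((ρ + 2 * t + 1) / 2 - 1)) * ((q - 1) * q ^ (ρ - 1)) : ℕ) : ℚ) ≠ 0 := by
    push_cast [Nat.cast_sub hq.le]
    exact mul_ne_zero (mul_ne_zero hq1 (pow_ne_zero _ hq0)) (mul_ne_zero hq1 (pow_ne_zero _ hq0))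
  rw [mul_inv_eq_iff_eq_mul₀ hden]
  push_cast [Nat.cast_sub hq.le]
  have hexp : (ρ + 2 * t - 1) + (2 * ρ - 1) = (2 * ρ + 2 * t - (ρ + 2 * t + 1) / 2) + (((ρ + 2 * t + 1) / 2 - 1) + (ρ - 1)) := by omega
  have key : (q : ℚ) ^ (ρ + 2 * t - 1) * (q : ℚ) ^ (2 * ρ - 1) =
      (q : ℚ) ^ (2 * ρ + 2 * t - (ρ + 2 * t + 1) / 2) * ((q : ℚ) ^ ((ρ + 2 * t + 1) / 2 - 1) * (q : ℚ) ^ (ρ - 1)) := by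
    rw [← pow_add, ← pow_add, ← pow_add, hexp]
  linear_combination ((q : ℚ) - 1) ^ 2 * key

/-! ## §2  The decomposition of the κ-census of the glued stable dualisable family -/

open Classical in
/-- **THE κ-CENSUS OF THE GLUED STABLE DUALISABLE FAMILY, BY CLASSES**: for `T = diag(s)` a unit diagonal (no regime assumption), ramified quadratum datum letters, the trace bound,
`ρ, t ≥ 1`, a complete irredundant system `R` (Finset) of the fixed elements of valuation `|ϖ|^{2t}` modulo `𝔭^{ρ+2t}`, and reference frames `V₀ g = V(1, 1, g)`:
`Σᶠ_{M ∈ {latt V(x,ζ,y″) : T·M = M, dualisable}} κ_i(M)·w(M) = q^{2ρ + 2t − ⌈(ρ+2t)∕2⌉} · Σ_{g ∈ R, T·latt V₀(g) = latt V₀(g)} κ_i(latt V₀(g))` (`κ_i = kappaCount σ ϖ 0 i`; the family is the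
disjoint union of the orbits of the STABLE representatives — ★ (iv-a) + ★ `mapGL_mapGL_diagGLUnits_eq_iff` — and `κ_i`, `w` are orbit constants, ★ κG-A1, ★ B5 (iii)).
[cite: Kottwitz1986BaseChangeUnits, §1 pp. 240–241] [cite: LanglandsShelstad1987, §3] [cite: Rogawski1990, §4.9 Prop. 4.9.1 (a) p. 55] -/
theorem finsum_kappaCount_mul_stabiliserWeight_glued_eq {σ : K →+* K} (hσ : ∀ a, σ (σ a) = a) (hvσ : ∀ a, Valued.v (σ a) = Valued.v a)
    (hfix : ∀ x : K, σ x = x → x ≠ 0 → ∃ n : ℤ, Valued.v x = exp (2 * n)) {ϖ : K} (hϖ : Valued.v ϖ = exp (-1 : ℤ))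
    {d : ℕ} (hd : Valued.v (ϖ - σ ϖ) = Valued.v ϖ ^ d) [Finite 𝓀[K]] (hTr : ∀ a : K, Valued.v (a + σ a) ≤ Valued.v ϖ * Valued.v a)
    {s : Fin 3 → K} (T : GL (Fin 3) K) (hT : (T : Matrix (Fin 3) (Fin 3) K) = Matrix.diagonal s)
    (ρ t : ℕ) (hρ : 1 ≤ ρ) (ht : 1 ≤ t) (R : Finset K) (hR1 : ∀ g ∈ R, σ g = g ∧ Valued.v g = Valued.v ϖ ^ (2 * t))
    (hR2 : ∀ f : K, σ f = f → Valued.v f = Valued.v ϖ ^ (2 * t) → ∃ g ∈ R, Valued.v (f - g) ≤ Valued.v ϖ ^ (ρ + 2 * t))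
    (hR3 : ∀ g ∈ R, ∀ g' ∈ R, Valued.v (g - g') ≤ Valued.v ϖ ^ (ρ + 2 * t) → g = g')
    (V₀ : K → GL (Fin 3) K) (hV₀ : ∀ g, (V₀ g : Matrix (Fin 3) (Fin 3) K) = !![1, 0, 0; 1, ϖ ^ ρ, 0; 1 * 1 + g, ϖ ^ ρ * 1, ϖ ^ (2 * ρ + 2 * t)]) (i : Fin 3) :
    ∑ᶠ M ∈ {M : Submodule 𝒪[K] (Fin 3 → K) | ∃ x ζ y'' : K, Valued.v x = 1 ∧ Valued.v ζ = 1 ∧ Valued.v y'' = Valued.v ϖ ^ (2 * t) ∧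
        M = latt (!![1, 0, 0; x, ϖ ^ ρ, 0; x * ζ + y'', ϖ ^ ρ * ζ, ϖ ^ (2 * ρ + 2 * t)] : Matrix (Fin 3) (Fin 3) K) ∧ mapGL T M = M ∧ IsDualisableLattice σ ϖ M},
        (kappaCount σ ϖ 0 i M : ℚ) * stabiliserWeight σ M =
      (Nat.card 𝓀[K] : ℚ) ^ (2 * ρ + 2 * t - (ρ + 2 * t + 1) / 2) *
        ∑ g ∈ R.filter (fun g => mapGL T (latt (V₀ g : Matrix (Fin 3) (Fin 3) K)) = latt (V₀ g : Matrix (Fin 3) (Fin 3) K)),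
          (kappaCount σ ϖ 0 i (latt (V₀ g : Matrix (Fin 3) (Fin 3) K)) : ℚ) := by
  obtain ⟨hϖ0, hϖ1⟩ := ne_zero_and_v_lt_one_of_v_eq_exp hϖ
  set Orb : K → Set (Submodule 𝒪[K] (Fin 3 → K)) := fun g => {M | ∃ u ∈ unitTorus K 3, M = mapGL (diagGLUnits u) (latt (V₀ g : Matrix (Fin 3) (Fin 3) K))}
    with hOrb
  set R' : Finset K := R.filter (fun g => mapGL T (latt (V₀ g : Matrix (Fin 3) (Fin 3) K)) = latt (V₀ g : Matrix (Fin 3) (Fin 3) K)) with hR'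
  have hvg : ∀ g ∈ R, Valued.v g < 1 := fun g hg => by
    rw [(hR1 g hg).2]; exact pow_lt_one₀ zero_le hϖ1 (by omega)
  have hlt : Valued.v ϖ ^ (ρ + 2 * t) < Valued.v ϖ ^ (2 * t) := by
    rw [pow_add, mul_comm]
    exact mul_lt_of_lt_one_right (pow_pos ((Valuation.pos_iff _).2 hϖ0) _) (pow_lt_one₀ zero_le hϖ1 (by omega))
  have h11 : Valued.v (1 : K) = 1 := map_one _
  -- the set identity: the family is the union of the orbits of the STABLE representatives
  have hset : {M : Submodule 𝒪[K] (Fin 3 → K) | ∃ x ζ y'' : K, Valued.v x = 1 ∧ Valued.v ζ = 1 ∧ Valued.v y'' = Valued.v ϖ ^ (2 * t) ∧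
        M = latt (!![1, 0, 0; x, ϖ ^ ρ, 0; x * ζ + y'', ϖ ^ ρ * ζ, ϖ ^ (2 * ρ + 2 * t)] : Matrix (Fin 3) (Fin 3) K) ∧ mapGL T M = M ∧
        IsDualisableLattice σ ϖ M} = ⋃ g ∈ (R' : Set K), Orb g := by
    ext M
    simp only [Set.mem_setOf_eq, Set.mem_iUnion, hOrb, hR', Finset.coe_filter, exists_prop]
    constructor
    · rintro ⟨x, ζ, y'', hx, hζ, hy'', rfl, hstab, hdual⟩
      obtain ⟨V, hV⟩ := exists_gl_coe_eq_glued x ζ y'' (pow_ne_zero ρ hϖ0) (pow_ne_zero _ hϖ0)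
      rw [← hV] at hdual
      obtain ⟨f, hσf, hκf⟩ := (isDualisableLattice_latt_glued_iff_exists_fixed_kappa hσ hvσ hϖ0 hϖ1 hTr ρ t hρ ht hx hζ hy'' V hV).1 hdual
      have hvκ : Valued.v (y'' / (x * ζ)) = Valued.v ϖ ^ (2 * t) := by rw [map_div₀, map_mul, hx, hζ, mul_one, div_one, hy'']
      have hvf : Valued.v f = Valued.v ϖ ^ (2 * t) := by
        have h := Valuation.map_sub_eq_of_lt_left Valued.v (hvκ ▸ hκf.trans_lt hlt : Valued.v (y'' / (x * ζ) - f) < Valued.v (y'' / (x * ζ)))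
        rw [← hvκ, ← h, sub_sub_cancel]
      obtain ⟨g, hg, hfg⟩ := hR2 f hσf hvf
      have hκg : Valued.v (y'' / (x * ζ) - g) ≤ Valued.v ϖ ^ (ρ + 2 * t) := by
        rw [show y'' / (x * ζ) - g = (y'' / (x * ζ) - f) + (f - g) by ring]
        exact Valuation.map_add_le _ hκf hfg
      obtain ⟨u, hu, hM⟩ := exists_mem_unitTorus_latt_glued_eq_mapGL hϖ0 ρ t hx hζ hy'' ht hϖ1 (hvg g hg) hκg (V₀ g) (hV₀ g)
      refine ⟨g, ⟨hg, ?_⟩, u, hu, hM⟩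
      -- the representative is stable because its translate `M` is
      rw [hM] at hstab
      exact (mapGL_mapGL_diagGLUnits_eq_iff u T hT _).1 hstab
    · rintro ⟨g, ⟨hg, hgst⟩, u, hu, rfl⟩
      obtain ⟨x', ζ', y₁, hx', hζ', hy₁, hκ, hM⟩ := exists_glued_of_mem_orbit u hu g (ϖ ^ ρ) (ϖ ^ (2 * ρ + 2 * t)) (V₀ g) (hV₀ g)
      have hy₁' : Valued.v y₁ = Valued.v ϖ ^ (2 * t) := by rw [hy₁, (hR1 g hg).2]
      obtain ⟨V, hV⟩ := exists_gl_coe_eq_glued x' ζ' y₁ (pow_ne_zero ρ hϖ0) (pow_ne_zero _ hϖ0)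
      refine ⟨x', ζ', y₁, hx', hζ', hy₁', hM, ?_, ?_⟩
      · exact (mapGL_mapGL_diagGLUnits_eq_iff u T hT _).2 hgst
      · rw [hM, ← hV]
        exact (isDualisableLattice_latt_glued_iff_exists_fixed_kappa hσ hvσ hϖ0 hϖ1 hTr ρ t hρ ht hx' hζ' hy₁' V hV).2
          ⟨g, (hR1 g hg).1, by rw [hκ, sub_self, map_zero]; exact zero_le⟩
  -- pairwise disjoint orbits
  have hdisj : (R' : Set K).PairwiseDisjoint Orb := by
    intro g hg g' hg' hne
    have hgR : g ∈ R := (Finset.mem_filter.1 hg).1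
    have hg'R : g' ∈ R := (Finset.mem_filter.1 hg').1
    rw [Function.onFun, Set.disjoint_left]
    intro M hM hM'
    apply hne
    simp only [hOrb, Set.mem_setOf_eq] at hM hM'
    obtain ⟨u, hu, rfl⟩ := hM
    obtain ⟨u', hu', hMM⟩ := hM'
    obtain ⟨x, ζ, y, hx, hζ, hy, hκ, h1⟩ := exists_glued_of_mem_orbit u hu g (ϖ ^ ρ) (ϖ ^ (2 * ρ + 2 * t)) (V₀ g) (hV₀ g)
    obtain ⟨x', ζ', y', hx', hζ', -, hκ', h2⟩ := exists_glued_of_mem_orbit u' hu' g' (ϖ ^ ρ) (ϖ ^ (2 * ρ + 2 * t)) (V₀ g') (hV₀ g')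
    have hyv : Valued.v y = Valued.v ϖ ^ (2 * t) := by rw [hy, (hR1 g hgR).2]
    have hv := v_kappa_sub_le_of_latt_glued_eq hϖ0 hϖ1.le ρ t hx hζ hyv hx' hζ' (h1.symm.trans (hMM.trans h2))
    rw [hκ, hκ'] at hv
    exact hR3 g hgR g' hg'R hv
  -- orbit sizes, the weight and the κ-count along an orbit
  have hN : ∀ g ∈ (R' : Set K), (Orb g).ncard = ((Nat.card 𝓀[K] - 1) * Nat.card 𝓀[K] ^ (ρ + 2 * t - 1)) * ((Nat.card 𝓀[K] - 1) * Nat.card 𝓀[K] ^ (2 * ρ - 1)) :=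
    fun g hg => ncard_unitTorus_orbit_latt_glued_eq hϖ hρ (2 * t) h11 h11 (by rw [(hR1 g (Finset.mem_filter.1 hg).1).2]) (V₀ g) (by rw [hV₀ g])
  have hq : 1 < Nat.card 𝓀[K] := Finite.one_lt_card
  have hN0 : ((Nat.card 𝓀[K] - 1) * Nat.card 𝓀[K] ^ (ρ + 2 * t - 1)) * ((Nat.card 𝓀[K] - 1) * Nat.card 𝓀[K] ^ (2 * ρ - 1)) ≠ 0 :=
    mul_ne_zero (mul_ne_zero (by omega) (pow_ne_zero _ (by omega))) (mul_ne_zero (by omega) (pow_ne_zero _ (by omega)))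
  have hfinOrb : ∀ g ∈ (R' : Set K), (Orb g).Finite := fun g hg => Set.finite_of_ncard_ne_zero (by rw [hN g hg]; exact hN0)
  have hw : ∀ g ∈ (R' : Set K), ∀ M ∈ Orb g, (kappaCount σ ϖ 0 i M : ℚ) * stabiliserWeight σ M =
      (kappaCount σ ϖ 0 i (latt (V₀ g : Matrix (Fin 3) (Fin 3) K)) : ℚ) *
        ((((Nat.card 𝓀[K] - 1) * Nat.card 𝓀[K] ^ ((ρ + 2 * t + 1) / 2 - 1)) * ((Nat.card 𝓀[K] - 1) * Nat.card 𝓀[K] ^ (ρ - 1)) : ℕ) : ℚ)⁻¹ := by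
    rintro g hg M ⟨u, -, rfl⟩
    have hgR : g ∈ R := (Finset.mem_filter.1 hg).1
    rw [kappaCount_mapGL_diagGLUnits hσ, stabiliserWeight_mapGL_diagGLUnits,
      stabiliserWeight_latt_glued_tube_eq hσ hvσ hfix hϖ hd hρ t h11 h11 (hR1 g hgR).2 (V₀ g) (hV₀ g) (hR1 g hgR).1
        (by rw [map_one, (hR1 g hgR).1, one_mul, sub_self, map_zero]; exact zero_le)]
  have hR'fin : (R' : Set K).Finite := R'.finite_toSet
  rw [hset, finsum_mem_biUnion hdisj hR'fin hfinOrb,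
    finsum_mem_congr rfl (fun g hg => finsum_mem_eq_ncard_mul (hfinOrb g hg) _ _ (hw g hg)),
    finsum_mem_congr rfl (fun g hg => by rw [hN g hg]), finsum_mem_coe_finset, ← orbit_mass_eq_pow hq hρ t, Finset.mul_sum]
  refine Finset.sum_congr rfl fun g _ => ?_
  ring

/-! ## §3  The stable representatives, by regime -/

/-- **ON THE TUBE EVERY REPRESENTATIVE IS STABLE** (`2ρ + 2t ≤ n₁`, `2ρ ≤ n₂`, `ρ ≤ n₃`; ★ B5 (ii)). [cite: Kottwitz1986BaseChangeUnits, §1 pp. 240–241] -/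
theorem mapGL_latt_glued_rep_of_depths {ϖ : K} (hϖ0 : ϖ ≠ 0) (hϖ1 : Valued.v ϖ ≤ 1) {α β : K} (hα : Valued.v α = 1) (hβ : Valued.v β = 1)
    (T : GL (Fin 3) K) (hT : (T : Matrix (Fin 3) (Fin 3) K) = Matrix.diagonal ![α, β, 1]) {n₁ n₂ n₃ : ℕ}
    (h₁ : Valued.v (β - 1) = Valued.v ϖ ^ n₁) (h₂ : Valued.v (α - 1) = Valued.v ϖ ^ n₂) (h₃ : Valued.v (β - α) = Valued.v ϖ ^ n₃)
    {ρ t : ℕ} (hρ₁ : 2 * ρ + 2 * t ≤ n₁) (hρ₂ : 2 * ρ ≤ n₂) (hρ₃ : ρ ≤ n₃) {g : K} (hg : Valued.v g = Valued.v ϖ ^ (2 * t))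
    (V : GL (Fin 3) K) (hV : (V : Matrix (Fin 3) (Fin 3) K) = !![1, 0, 0; 1, ϖ ^ ρ, 0; 1 * 1 + g, ϖ ^ ρ * 1, ϖ ^ (2 * ρ + 2 * t)]) :
    mapGL T (latt (V : Matrix (Fin 3) (Fin 3) K)) = latt (V : Matrix (Fin 3) (Fin 3) K) :=
  mapGL_latt_hnf_glued_eq_of_depths hϖ0 hϖ1 hα hβ T hT h₁ h₂ h₃ ρ (2 * t) hρ₁ hρ₂ hρ₃ (x := 1) (ζ := 1) (by simp) (by simp) hg V hV

/-- **ON THE GLUE FOOT A REPRESENTATIVE IS STABLE IFF ITS CLASS IS NEAR `−(β−1)∕(α−1)`**: `T·latt V(1,1,g) = latt V(1,1,g) ⟺ |g + (β−1)∕(α−1)| ≤ |ϖ|^{2ρ+2t−m}` (★ F3a at `x = ζ = 1`,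
`κ = g`). [cite: Kottwitz1986BaseChangeUnits, §1 pp. 240–241] -/
theorem mapGL_latt_glued_rep_iff {ϖ : K} (hϖ : Valued.v ϖ = exp (-1 : ℤ)) {α β : K} (hα : Valued.v α = 1) (hβ : Valued.v β = 1)
    (T : GL (Fin 3) K) (hT : (T : Matrix (Fin 3) (Fin 3) K) = Matrix.diagonal ![α, β, 1]) {m t : ℕ}
    (h₁ : Valued.v (β - 1) = Valued.v ϖ ^ (m + 2 * t)) (h₂ : Valued.v (α - 1) = Valued.v ϖ ^ m) (h₃ : Valued.v (β - α) = Valued.v ϖ ^ m)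
    {ρ : ℕ} (hρm : ρ ≤ m) (hm : m ≤ 2 * ρ + 2 * t) (g : K) (V : GL (Fin 3) K)
    (hV : (V : Matrix (Fin 3) (Fin 3) K) = !![1, 0, 0; 1, ϖ ^ ρ, 0; 1 * 1 + g, ϖ ^ ρ * 1, ϖ ^ (2 * ρ + 2 * t)]) :
    mapGL T (latt (V : Matrix (Fin 3) (Fin 3) K)) = latt (V : Matrix (Fin 3) (Fin 3) K) ↔
      Valued.v (g + (β - 1) / (α - 1)) ≤ Valued.v ϖ ^ (2 * ρ + 2 * t - m) := by
  have h := mapGL_latt_glued_eq_iff_kappa hϖ hα hβ T hT h₁ h₂ h₃ hρm hm (x := 1) (ζ := 1) (y'' := g) (by simp) (by simp) V hV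
  rwa [mul_one, div_one] at h

end Summit.HodgeConjecture.HodgeConjecture.Cruxes.H413.F0P3cDyRamDiagonalKappaGluedDecomposition

end
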